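import Summits.QuantumFields.YangMills.Theses.BalabanUVNodes

/-!
# `StabilityBAtRecord` ⟨stmt-QuantumFields-19183⟩ — LINE-FIRST SKELETON `stability_b_at_record` (line-writer seat `linewriter-ym-nodeo-1` g0, operator priority28, 2026-08-31)
# route `route-QuantumFields-BalabanUVNodes` (rev 38) · aside (rank 4; rev-0 Stage-0 text; HOLD E1 «misstated at Stage 0 — junk-provable» ✓p409380 ∕ ✓p409394)

THE ITEM AS THE ROUTE READS IT.  `StabilityBAtRecord F` asks for SOME Stage-0 datum of record `D` (`Node00.IsDatumOfRecord₀ F 2 D` — the record's block averaging only) carrying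
(B) `B16.EndStatementBPrinted D.C` and runs in every small window.  AS TYPED it is junk-closable (the flat Stage-0 witness `T4FiniteEpsInhabitedB.exists_isDatumOfRecord₀_endStatementBPrinted_window`
✓p409380, `BalabanUVNodesStage0FlatWitness` ✓p409394 — whence the hold); its CONTENT lives at the live pin, the σ∕choice-free («Ax») Stage-13 record of K0ᴬ ⟨27238⟩ ∕ K1ᴬ ⟨27239⟩.
This skeleton is the NON-VACUOUS road and nothing else: the datum is THE DATUM OF RECORD `Node00.datumOfRecord₁₃SepCoPHVAx F 2 θ h v` of an admissible Stage-13 tuple (K0ᴬ, by name,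
an OPEN route item — admissible hypothesis), its Stage-0 face is the tree's `rfl` lemma `Node00.isDatumOfRecord₀_datumOfRecord₁₃SepCoPHVAx` (the face the route's `closes` uses), and
(B) ∧ window come from ONE registered stub — **K1ᴬ's text with the RUN-ROWS conjunct deleted** («(B) and the window at SOME admissible Ax record»), i.e. exactly this item's content
re-pinned at the live record.  The stub is a PROPER WEAKENING of the live crux K1ᴬ `StabilityBRunRowsAtRecordR13SepCoPHVAx` (kernel certificate `stub_of_K1Ax` below: projection), so
closing K1ᴬ closes it by one line, and any earlier road to (B)+window at the Ax record (without NODE O's β-rows (i)(iv)(C)) closes this item before K1ᴬ.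
Also in tree, NOT used (ex falso): `BalabanLadderUVNodesRecord11.stabilityBAtRecord_of_nodes (h0 : Record11Inhabited) (h1 : StabilityBAtRecordR11e)` — its two hypotheses are jointly
unsatisfiable (`…Negative.StabilityBAtRecordR11e_false_of_Record11Inhabited`).

ONE `sorry` (the stub); theorems concluding the crux BY NAME: `StabilityBAtRecord_of` (hypotheses K0ᴬ by name + the stub by its registration name) and `stabilityBAtRecord_of_axCone`
(K0ᴬ only).  HONEST LABEL: supply for hands, not progress; the item stays an ASIDE on hold (nothing here lifts the hold or books anything); nothing of Bałaban proved; NODE O not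
advanced; `closes` reaches only the CONDITIONAL finite-𝕋⁴ rung `BalabanLadder.UV` (R4) at fixed ε; NOT ℝ⁴ ∕ OS ∕ Clay — the Yang–Mills mass gap is NOT proved by any of this.
[V] = Balaban1989LargeFieldII Thm 1 p.355 ((B)); [I] = Balaban1987RG1 Thm 2 p.259 (the window); [III] = Balaban1988Convergent Thm 1 p.262.
-/

open Literature.MathematicalPhysics.QuantumFieldTheory.Balaban1983to89
open Literature.MathematicalPhysics.QuantumFieldTheory.Balaban1983to89.T4Continuum

namespace Summit.QuantumFields.YangMills.Theses.BalabanUVNodes.StabilityBAtRecordSkeletonV1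

/-! ## §1. The registered stub: (B) ∧ window at SOME admissible Ax record (= K1ᴬ minus the run rows) -/

/-- **stub — (B) and the small-coupling window at some admissible σ∕choice-free Stage-13 record of every family that has one** (K1ᴬ `StabilityBRunRowsAtRecordR13SepCoPHVAx`'s text
VERBATIM with the run-rows conjunct `∃ (b r γ₀ M), …` deleted).  PRINT: [V] Thm 1 p.355 ((B) = the printed end-statement at the last step) + [I] Thm 2 p.259 (runs in every window
`]0, γ]`), read at the record; in the live K1ᴬ line (plan D102 V11.2) both come from the node tokens + run letters (`endStatementBPrinted_window_of_recordSV_of_nodes_of_runLetters`),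
so the cheapest known road still passes through the β-rows — a rows-free road would be new.  Size L. -/
theorem stub_endStatementBWindowAtSomeAxRecord :
    ∀ F : T4Family, (∃ θ : Node00.Stage13HParams F 2, θ.Provisos₁₃SepCoPHAx F 2 ∧ (θ.ZhUnity F 2 ∧ θ.SlotsNondegenerate₁₃Ax F 2) ∧ θ.Admissible F 2) →
      ∃ (θ : Node00.Stage13HParams F 2) (h : θ.Provisos₁₃SepCoPHAx F 2) (v : Node00.Revision₁₃Ax F 2 θ h),
        (θ.ZhUnity F 2 ∧ θ.SlotsNondegenerate₁₃Ax F 2) ∧ θ.Admissible F 2 ∧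
        B16.EndStatementBPrinted (Node00.datumOfRecord₁₃SepCoPHVAx F 2 θ h v).C ∧
        (∃ γ₁ : ℝ, 0 < γ₁ ∧ ∀ γ : ℝ, 0 < γ → γ ≤ γ₁ →
          ∃ P : B12.RunParams, 1 ≤ P.K ∧ ((Node00.datumOfRecord₁₃SepCoPHVAx F 2 θ h v).C P).flow.InInterval γ P.K) := by
  sorry

/-- Registration name of the stub (its statement verbatim as a reducible abbreviation NAMED LIKE THE STUB), so that `StabilityBAtRecord_of`'s second binder is admissible for
`#h21_check_skeleton` rule (ii) (device of the porter's `pta_residueW.lean`). -/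
abbrev Registered.stub_endStatementBWindowAtSomeAxRecord : Prop :=
  ∀ F : T4Family, (∃ θ : Node00.Stage13HParams F 2, θ.Provisos₁₃SepCoPHAx F 2 ∧ (θ.ZhUnity F 2 ∧ θ.SlotsNondegenerate₁₃Ax F 2) ∧ θ.Admissible F 2) →
      ∃ (θ : Node00.Stage13HParams F 2) (h : θ.Provisos₁₃SepCoPHAx F 2) (v : Node00.Revision₁₃Ax F 2 θ h),
        (θ.ZhUnity F 2 ∧ θ.SlotsNondegenerate₁₃Ax F 2) ∧ θ.Admissible F 2 ∧
        B16.EndStatementBPrinted (Node00.datumOfRecord₁₃SepCoPHVAx F 2 θ h v).C ∧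
        (∃ γ₁ : ℝ, 0 < γ₁ ∧ ∀ γ : ℝ, 0 < γ → γ ≤ γ₁ →
          ∃ P : B12.RunParams, 1 ≤ P.K ∧ ((Node00.datumOfRecord₁₃SepCoPHVAx F 2 θ h v).C P).flow.InInterval γ P.K)

/-! ## §2. Kernel certificates: the stub is a PROJECTION of the live crux K1ᴬ; the crux's Stage-0 face is `rfl` -/

/-- **WEAKER THAN K1ᴬ** (kernel, no sorry): the live crux `StabilityBRunRowsAtRecordR13SepCoPHVAx` ⟨27239⟩ implies the stub by dropping its run-rows conjunct. -/
theorem stub_of_K1Ax (h1 : Summit.QuantumFields.YangMills.Theses.BalabanUVNodes.StabilityBRunRowsAtRecordR13SepCoPHVAx) :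
    Registered.stub_endStatementBWindowAtSomeAxRecord := by
  intro F hF
  obtain ⟨θ, h, v, hU, hθ, hb, hwin, -⟩ := h1 F hF
  exact ⟨θ, h, v, hU, hθ, hb, hwin⟩

/-! ## §3. Composition BY NAME -/

/-- **★ `StabilityBAtRecord` from K0ᴬ (by name) and the stub (by its registration name).**  The datum is the Ax datum of record; its Stage-0 face is
`Node00.isDatumOfRecord₀_datumOfRecord₁₃SepCoPHVAx` (`rfl`); the window's `1 ≤ P.K` is dropped.  No `sorry` here. -/
theorem StabilityBAtRecord_of (h0 : Summit.QuantumFields.YangMills.Theses.BalabanUVNodes.Record13SepCoPHInhabitedAx)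
    (hBW : Registered.stub_endStatementBWindowAtSomeAxRecord) :
    Summit.QuantumFields.YangMills.Theses.BalabanUVNodes.StabilityBAtRecord := by
  intro F
  obtain ⟨θ, h, v, -, -, hb, γ₁, hγ₁, hwin⟩ := hBW F (h0 F)
  refine ⟨Node00.datumOfRecord₁₃SepCoPHVAx F 2 θ h v, Node00.isDatumOfRecord₀_datumOfRecord₁₃SepCoPHVAx F 2 θ h v, hb, γ₁, hγ₁, ?_⟩
  intro γ hγ hγ'
  obtain ⟨P, -, hP⟩ := hwin γ hγ hγ'
  exact ⟨P, hP⟩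

/-- **★ THE SKELETON THEOREM — `StabilityBAtRecord` from the live cone's K0ᴬ ⟨27238⟩ (OPEN route item, by name) and the ONE registered stub.** -/
theorem stabilityBAtRecord_of_axCone (h0 : Summit.QuantumFields.YangMills.Theses.BalabanUVNodes.Record13SepCoPHInhabitedAx) :
    Summit.QuantumFields.YangMills.Theses.BalabanUVNodes.StabilityBAtRecord :=
  StabilityBAtRecord_of h0 stub_endStatementBWindowAtSomeAxRecord

/-- Corollary (kernel, no sorry): the live cone K0ᴬ ∧ K1ᴬ already implies this aside — nothing separate is ever needed for ⟨19183⟩ once ⟨27238⟩ ∕ ⟨27239⟩ close. -/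
theorem stabilityBAtRecord_of_K0Ax_K1Ax (h0 : Summit.QuantumFields.YangMills.Theses.BalabanUVNodes.Record13SepCoPHInhabitedAx)
    (h1 : Summit.QuantumFields.YangMills.Theses.BalabanUVNodes.StabilityBRunRowsAtRecordR13SepCoPHVAx) :
    Summit.QuantumFields.YangMills.Theses.BalabanUVNodes.StabilityBAtRecord :=
  StabilityBAtRecord_of h0 (stub_of_K1Ax h1)

end Summit.QuantumFields.YangMills.Theses.BalabanUVNodes.StabilityBAtRecordSkeletonV1
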